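import Literature.NumberTheory.Automorphic.HidaLevelAdaptedFamily
import Literature.NumberTheory.Automorphic.GL2AdelicInvariantFunctionsDet
import HarnessLib

/-!
# Invariant sections at the unipotent representatives: the shift identity for `GL₂`

Topic `NumberTheory/Automorphic`; namespace `Literature.NumberTheory.Automorphic.BigHeckeGLn`;
theorems only (no new definitions, no named fact, no `sorry`).

The `GL₂` discharge of the hypothesis `hshift` of `LevelControlDegreeZeroShift` (and of `hdet` of
`LevelControlDegreeZero` when the unipotents act trivially on the coefficients) for the induced
coefficient systems `𝓕(N) = M(U', N ⊗ V)` at the Hida levels `U(c,c) ⊴ U' = U(b',c)` and the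
unipotent family `α_j = N(x_j) t_v^r` (`HidaLevelAdaptedFamily`).  For a `GL₂(K)`-invariant
section `F`:

* `apply_mul_eq_of_tau_eq_one` — `F(h w) = F(h)` for `w ∈ U(c,c)` acting trivially on `V`;
* `apply_mul_globalUnipotent_mul_eq` — `F(g N(x) t^r) = F(g t^r N(x))`: both have the same
  determinant, so differ by `SL₂(K)` on the left and an element of any open subgroup on the right
  (strong approximation, `exists_globalEmbedding_toGL_mul_mul_eq_of_det_eq`);
  [cite: Bump1997, Thm. 3.3.1] [cite: KhareThorne2017, §6.2]
* **`apply_mul_unipotentFamily_eq`** — `F(g α_j) = (1 ⊗ τ(N(-x_j))) F(g t^r)` (the section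
  property at `N(x_j) ∈ U(c,c) = ker π`), i.e. `hshift` with `b = t^r`, `e_j = τ(N(-x_j))`;
* `apply_mul_unipotentFamily_eq_of_unipotent_trivial` — if moreover the `N(x)` act trivially on `V`
  then `F(g α_j) = F(g α_{j₀})` (`hdet`). [cite: Hida1994AIF, §3, proof of Thm 3.2]

## References

* D. Bump, *Automorphic forms and representations* (1997), Thm. 3.3.1. [Bump1997]
* C. Khare, J. A. Thorne, Amer. J. Math. 139 (2017), §6.2–6.3. [KhareThorne2017]
* H. Hida, Ann. Inst. Fourier 44 (1994), §3. [Hida1994AIF]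
-/

noncomputable section

open scoped NumberField TensorProduct
open IsDedekindDomain

namespace Literature.NumberTheory.Automorphic

namespace BigHeckeGLn

namespace TameLevel

open LevelAction

variable {K : Type} [Field K] [NumberField K] {p : ℕ} [Fact p.Prime] (𝒰 : TameLevel 2 K p)
  {v : HeightOneSpectrum (𝓞 K)}
  {R : Type} [CommRing R] {Δ : Submonoid (FiniteAdelicGL 2 K)} {V : Type} [AddCommGroup V]
  [Module R V] (τ : Δ →* Module.End R V) {b' c : ℕ} (hU' : (𝒰.level b' c).toSubmonoid ≤ Δ)
  [((𝒰.level c c).subgroupOf (𝒰.level b' c)).Normal]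
  {N : Type} [AddCommGroup N] [Module R N]
  (ρ : Representation R (𝒰.level b' c ⧸ (𝒰.level c c).subgroupOf (𝒰.level b' c)) N)

/-- The coefficient endomorphism of `w ∈ U(c,c)` acting trivially on `V` is the identity on
`N ⊗ V` (`π(w) = 1`). [folklore] -/
theorem inducedCoeff_eq_id_of_tau_eq_one (hb' : b' ≤ c) {w : FiniteAdelicGL 2 K}
    (hw : w ∈ 𝒰.level c c)
    (hτw : τ ⟨w, hU' (𝒰.level_antitone hb' le_rfl hw)⟩ = 1) :
    inducedCoeff τ hU' (QuotientGroup.mk' ((𝒰.level c c).subgroupOf (𝒰.level b' c))) ρ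
      ⟨w, 𝒰.level_antitone hb' le_rfl hw⟩ = LinearMap.id := by
  refine TensorProduct.ext' fun n x => ?_
  rw [inducedCoeff_apply_tmul, LinearMap.id_apply]
  have hπ : QuotientGroup.mk' ((𝒰.level c c).subgroupOf (𝒰.level b' c))
      (toSubgroupHom _ ⟨w, 𝒰.level_antitone hb' le_rfl hw⟩) = 1 :=
    (𝒰.mem_level_iff_mk'_eq_one ⟨w, _⟩).1 hw
  rw [hπ, map_one, Module.End.one_apply]
  exact congrArg (n ⊗ₜ[R] ·) (LinearMap.congr_fun hτw x)

/-- **Right-invariance**: a section `F` of `𝓕(N)` satisfies `F(h w) = F(h)` for `w ∈ U(c,c)` acting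
trivially on `V`. [folklore] -/
theorem apply_mul_eq_of_tau_eq_one (hb' : b' ≤ c) {F : FiniteAdelicGL 2 K → N ⊗[R] V}
    (hF : F ∈ sections (𝒰.level b' c).toSubmonoid
      (inducedCoeff τ hU' (QuotientGroup.mk' ((𝒰.level c c).subgroupOf (𝒰.level b' c))) ρ)
      (𝒰.level b' c))
    {w : FiniteAdelicGL 2 K} (hw : w ∈ 𝒰.level c c)
    (hτw : τ ⟨w, hU' (𝒰.level_antitone hb' le_rfl hw)⟩ = 1) (h : FiniteAdelicGL 2 K) :
    F (h * w) = F h := by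
  have key := (mem_sections_iff (level_le_self (U' := 𝒰.level b' c))).1 hF h w
    (𝒰.level_antitone hb' le_rfl hw)
  rw [𝒰.inducedCoeff_eq_id_of_tau_eq_one τ hU' ρ hb' hw hτw, LinearMap.id_apply] at key
  exact key

/-- **`F(g N(x) t^r) = F(g t^r N(x))` for `GL₂(K)`-invariant sections** right-invariant under an
open subgroup: strong approximation for `SL₂`. [cite: Bump1997, Thm. 3.3.1]
[cite: KhareThorne2017, §6.2] -/
theorem apply_mul_globalUnipotent_mul_eq {W : Subgroup (FiniteAdelicGL 2 K)}
    (hWo : IsOpen (W : Set (FiniteAdelicGL 2 K))) {M : Type} (F : FiniteAdelicGL 2 K → M)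
    (hFW : ∀ (h : FiniteAdelicGL 2 K) (w : FiniteAdelicGL 2 K), w ∈ W → F (h * w) = F h)
    (hFΓ : ∀ (γ : GL (Fin 2) K) (h : FiniteAdelicGL 2 K), F (globalEmbedding 2 K γ * h) = F h)
    (g : FiniteAdelicGL 2 K) (x : v.adicCompletion K) (r : ℕ) :
    F (g * (globalUnipotent K v x * heckeElement 2 K v 1 ^ r)) =
      F (g * heckeElement 2 K v 1 ^ r * globalUnipotent K v x) := by
  have hdet : Matrix.GeneralLinearGroup.det (g * (globalUnipotent K v x * heckeElement 2 K v 1 ^ r)) =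
      Matrix.GeneralLinearGroup.det (g * heckeElement 2 K v 1 ^ r * globalUnipotent K v x) := by
    simp only [map_mul]
    rw [mul_assoc, mul_comm (Matrix.GeneralLinearGroup.det (globalUnipotent K v x))]
  obtain ⟨γ, w, hw, hγ⟩ := exists_globalEmbedding_toGL_mul_mul_eq_of_det_eq W hWo hdet
  rw [← hγ, hFW _ _ hw, hFΓ]

/-- For a `Γ`-invariant section, `F(ι(γ) h) = F(h)`. [folklore] -/
theorem apply_globalEmbedding_mul_of_forall_leftTranslation_eq {M : Type} [AddCommGroup M]
    [Module R M] {F : FiniteAdelicGL 2 K → M}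
    (hinv : ∀ γ : GL (Fin 2) K, leftTranslation R (globalEmbedding 2 K) M γ F = F)
    (γ : GL (Fin 2) K) (h : FiniteAdelicGL 2 K) : F (globalEmbedding 2 K γ * h) = F h := by
  have e := congrFun (hinv γ⁻¹) h
  rwa [leftTranslation_apply, map_inv, inv_inv] at e

/-- **The shift identity `F(g α_j) = (1 ⊗ τ(N(-x_j))) F(g t^r)`** for `GL₂(K)`-invariant sections of
`𝓕(N)` at level `U(b',c)`, the unipotent family `α_j = N(x_j) t_v^r` of `U(c,c) t_v^r U(c,c)`, and
coefficients `V` on which some open `W ≤ U(c,c)` acts trivially: the hypothesis `hshift` of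
`LevelControlDegreeZeroShift` with `b = t_v^r`, `e_j = τ(N(-x_j))`.
[cite: Hida1994AIF, §3, proof of Thm 3.2] [cite: KhareThorne2017, §6.3] -/
theorem apply_mul_unipotentFamily_eq (h𝒰 : 𝒰.IsMaximalAbove) (hv : (p : 𝓞 K) ∈ v.asIdeal)
    {r : ℕ} (hr : r ≤ c) (hb' : b' ≤ c)
    {W : Subgroup (FiniteAdelicGL 2 K)} (hWo : IsOpen (W : Set (FiniteAdelicGL 2 K)))
    (hWU : W ≤ 𝒰.level c c)
    (hWτ : ∀ (w : FiniteAdelicGL 2 K) (hw : w ∈ W),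
      τ ⟨w, hU' (𝒰.level_antitone hb' le_rfl (hWU hw))⟩ = 1)
    {F : FiniteAdelicGL 2 K → N ⊗[R] V}
    (hF : F ∈ sections (𝒰.level b' c).toSubmonoid
      (inducedCoeff τ hU' (QuotientGroup.mk' ((𝒰.level c c).subgroupOf (𝒰.level b' c))) ρ)
      (𝒰.level b' c))
    (hinv : ∀ γ : GL (Fin 2) K, leftTranslation R (globalEmbedding 2 K) (N ⊗[R] V) γ F = F)
    (g : FiniteAdelicGL 2 K)
    (j : ArithmeticQuotient.doubleCosetQuot (𝒰.level c c) (heckeElement 2 K v 1 ^ r)) :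
    F (g * 𝒰.unipotentFamily c r j) =
      (τ ⟨globalUnipotent K v (-𝒰.unipotentRep v c r j), hU' ((𝒰.globalUnipotent_mem_level_iff h𝒰 hv
        b' c _).2 (by rw [Valuation.map_neg]; exact (𝒰.unipotentRep_spec h𝒰 hv hr j.2).1))⟩).lTensor N
        (F (g * heckeElement 2 K v 1 ^ r)) := by
  set x := 𝒰.unipotentRep v c r j with hx
  have hx1 : Valued.v x ≤ 1 := (𝒰.unipotentRep_spec h𝒰 hv hr j.2).1
  have hxn1 : Valued.v (-x) ≤ 1 := by rwa [Valuation.map_neg]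
  have hNU : globalUnipotent K v x ∈ 𝒰.level c c := (𝒰.globalUnipotent_mem_level_iff h𝒰 hv c c x).2 hx1
  have hNU' : globalUnipotent K v x ∈ 𝒰.level b' c := 𝒰.level_antitone hb' le_rfl hNU
  have hnNU' : globalUnipotent K v (-x) ∈ 𝒰.level b' c :=
    (𝒰.globalUnipotent_mem_level_iff h𝒰 hv b' c _).2 hxn1
  -- strong approximation: `F(g N(x) t^r) = F(g t^r N(x))`
  have h1 : F (g * 𝒰.unipotentFamily c r j) = F (g * heckeElement 2 K v 1 ^ r * globalUnipotent K v x) :=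
    apply_mul_globalUnipotent_mul_eq hWo F
      (fun h w hw => 𝒰.apply_mul_eq_of_tau_eq_one τ hU' ρ hb' hF (hWU hw) (hWτ w hw) h)
      (apply_globalEmbedding_mul_of_forall_leftTranslation_eq hinv) g x r
  -- section property at `N(x) ∈ ker π`
  have h2 := (mem_sections_iff (level_le_self (U' := 𝒰.level b' c))).1 hF
    (g * heckeElement 2 K v 1 ^ r) (globalUnipotent K v x) hNU'
  have hπ : QuotientGroup.mk' ((𝒰.level c c).subgroupOf (𝒰.level b' c))
      (toSubgroupHom _ ⟨globalUnipotent K v x, hNU'⟩) = 1 :=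
    (𝒰.mem_level_iff_mk'_eq_one ⟨_, hNU'⟩).1 hNU
  have hcoeff : inducedCoeff τ hU' (QuotientGroup.mk' ((𝒰.level c c).subgroupOf (𝒰.level b' c))) ρ
      ⟨globalUnipotent K v x, hNU'⟩ = (τ ⟨globalUnipotent K v x, hU' hNU'⟩).lTensor N := by
    refine TensorProduct.ext' fun n y => ?_
    rw [inducedCoeff_apply_tmul, hπ, map_one, Module.End.one_apply, LinearMap.lTensor_tmul]
    rfl
  rw [hcoeff] at h2
  -- apply `1 ⊗ τ(N(-x))` to `h2`
  have h3 := congrArg ((τ ⟨globalUnipotent K v (-x), hU' hnNU'⟩).lTensor N) h2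
  rw [← LinearMap.comp_apply, ← LinearMap.lTensor_comp, ← Module.End.mul_eq_comp, ← map_mul] at h3
  have hone : (⟨globalUnipotent K v (-x), hU' hnNU'⟩ * ⟨globalUnipotent K v x, hU' hNU'⟩ : Δ) = 1 :=
    Subtype.ext (by
      rw [Submonoid.coe_mul, Submonoid.coe_one, globalUnipotent_mul, neg_add_cancel,
        globalUnipotent, localUnipotent_zero, map_one])
  rw [hone, map_one, Module.End.one_eq_id, LinearMap.lTensor_id, LinearMap.id_apply] at h3
  rw [h1, h3]

/-- **If the unipotents act trivially on `V`, invariant sections take equal values at all `g α_j`**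
(the hypothesis `hdet` of `LevelControlDegreeZero`; e.g. trivial coefficients).
[cite: Hida1994AIF, §3, proof of Thm 3.2] -/
theorem apply_mul_unipotentFamily_eq_of_unipotent_trivial (h𝒰 : 𝒰.IsMaximalAbove)
    (hv : (p : 𝓞 K) ∈ v.asIdeal) {r : ℕ} (hr : r ≤ c) (hb' : b' ≤ c)
    {W : Subgroup (FiniteAdelicGL 2 K)} (hWo : IsOpen (W : Set (FiniteAdelicGL 2 K)))
    (hWU : W ≤ 𝒰.level c c)
    (hWτ : ∀ (w : FiniteAdelicGL 2 K) (hw : w ∈ W),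
      τ ⟨w, hU' (𝒰.level_antitone hb' le_rfl (hWU hw))⟩ = 1)
    (hNτ : ∀ (x : v.adicCompletion K) (hx : Valued.v x ≤ 1),
      τ ⟨globalUnipotent K v x, hU' ((𝒰.globalUnipotent_mem_level_iff h𝒰 hv b' c x).2 hx)⟩ = 1)
    {F : FiniteAdelicGL 2 K → N ⊗[R] V}
    (hF : F ∈ sections (𝒰.level b' c).toSubmonoid
      (inducedCoeff τ hU' (QuotientGroup.mk' ((𝒰.level c c).subgroupOf (𝒰.level b' c))) ρ)
      (𝒰.level b' c))
    (hinv : ∀ γ : GL (Fin 2) K, leftTranslation R (globalEmbedding 2 K) (N ⊗[R] V) γ F = F)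
    (g : FiniteAdelicGL 2 K)
    (j j₀ : ArithmeticQuotient.doubleCosetQuot (𝒰.level c c) (heckeElement 2 K v 1 ^ r)) :
    F (g * 𝒰.unipotentFamily c r j) = F (g * 𝒰.unipotentFamily c r j₀) := by
  rw [𝒰.apply_mul_unipotentFamily_eq τ hU' ρ h𝒰 hv hr hb' hWo hWU hWτ hF hinv g j,
    𝒰.apply_mul_unipotentFamily_eq τ hU' ρ h𝒰 hv hr hb' hWo hWU hWτ hF hinv g j₀, hNτ, hNτ]
  · rw [Valuation.map_neg]; exact (𝒰.unipotentRep_spec h𝒰 hv hr j₀.2).1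
  · rw [Valuation.map_neg]; exact (𝒰.unipotentRep_spec h𝒰 hv hr j.2).1

end TameLevel

end BigHeckeGLn

end Literature.NumberTheory.Automorphic
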